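import Summits.QuantumFields.YangMills.Theorems.CurvatureKernelBound.Negative.GFFEuler

/-!
# `CurvatureKernelBound` — negative lemmas, chain C II: the dimension-5 generalised free field kernel `K₅`

Supports crux item `stmt-QuantumFields-11687` (`PencilRigidity.CurvatureKernelBound`). Standing disprover's negative
lemmas (refuter, cdisprove cycle 3), chain C: the dimension-5 generalised free field through the generic admissible-kernel
pipeline, culminating in `GFF.not_axialGrowthOfEuclideanPackage` (even full `O(4)`-invariance on `⁰𝒮` and E2 in EVERY frame
do not bound the order of the two-point singularity). No conclusion below asserts a Theses statement positively.

The free kernel is radial (`G_isometry`), radially antitone (`G_antitone`), continuous off `0` (`continuousOn_G`, dominated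
convergence) and jointly measurable in `(m, x)`; the Källén–Lehmann superposition `K₅(w) = ∫_{μ>2} μ⁷ G_μ(w) dμ` (`K5`)
is non-negative, measurable, `O(4)`-invariant, even, radially antitone, continuous off `0`, `K₅ ≤ A₅‖w‖⁻¹⁰` (`K5_le`),
`e⁻²/(4π²)‖w‖⁻¹⁰ ≤ K₅(w)` for `‖w‖ ≤ 1/2` (`K5_ge`: ORDER EXACTLY TEN), `K₅ ≤ C e^{-‖w‖}` for `‖w‖ ≥ 2` (`K5_le_exp`)
and obeys the time decay `K₅(w − te₀) ≤ e²(1 + eul 7 2 1) e^{-t}(1 + K₅(w))` for `w⁰ ≤ 0` (`K5_sub_time_le`). [folklore]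
-/

open scoped BigOperators Topology SchwartzMap
open MeasureTheory Filter Set Real
open Literature.MathematicalPhysics.QuantumLattice Literature.MathematicalPhysics.AQFT
open Literature.Analysis.UnboundedOperators

noncomputable section

namespace Summit.QuantumFields.YangMills.Theorems.CurvatureKernelBound.Negative

namespace GFF

open FreeKernel

/-- `G_m ≥ 0`. [folklore] -/
theorem G_nonneg (m : ℝ) (x : E4) : 0 ≤ G m x :=
  setIntegral_nonneg measurableSet_Ioi fun _ ht =>
    mul_nonneg (Real.exp_pos _).le (heatKernel_pos (mem_Ioi.1 ht) x).le

/-! ### The free kernel: radiality, monotonicity, continuity off `0`, measurability -/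

/-- Auxiliary fact `G_eq_of_norm_eq` (see the module docstring). [folklore] -/
theorem G_eq_of_norm_eq {m : ℝ} {x y : E4} (h : ‖x‖ = ‖y‖) : G m x = G m y := by
  rw [G_eq, G_eq, h]

/-- Auxiliary fact `G_isometry` of the generalised-free-field witness (see the module docstring). [folklore] -/
theorem G_isometry (m : ℝ) (R : E4 ≃ₗᵢ[ℝ] E4) (x : E4) : G m (R x) = G m x :=
  G_eq_of_norm_eq (R.norm_map x)

/-- Auxiliary fact `G_neg` of the generalised-free-field witness (see the module docstring). [folklore] -/
theorem G_neg (m : ℝ) (x : E4) : G m (-x) = G m x := G_eq_of_norm_eq (norm_neg x)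

/-- Auxiliary fact `φ_antitone` of the generalised-free-field witness (see the module docstring). [folklore] -/
theorem φ_antitone {r r' : ℝ} (hr : 0 ≤ r) (h : r ≤ r') {t : ℝ} (ht : 0 < t) : φ r' t ≤ φ r t := by
  unfold φ
  gcongr

/-- Auxiliary fact `integrableOn_expφ` of the generalised-free-field witness (see the module docstring). [folklore] -/
theorem integrableOn_expφ {m r : ℝ} (hr : r ≠ 0) :
    IntegrableOn (fun t => Real.exp (-m ^ 2 * t) * φ r t) (Ioi 0) := by
  refine (integrableOn_φ_Ioi hr le_rfl).mono' ?_ ?_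
  · exact ((Real.continuous_exp.comp (continuous_const.mul continuous_id)).aestronglyMeasurable).mul
      (integrableOn_φ_Ioi hr le_rfl).aestronglyMeasurable
  · refine (ae_restrict_iff' measurableSet_Ioi).2 (ae_of_all _ fun t ht => ?_)
    rw [Real.norm_eq_abs, abs_mul, abs_of_nonneg (Real.exp_pos _).le, abs_of_nonneg (φ_nonneg _ _)]
    refine mul_le_of_le_one_left (φ_nonneg _ _) ?_
    rw [Real.exp_le_one_iff]
    nlinarith [mem_Ioi.1 ht, sq_nonneg m]

/-- `G_m` is radially non-increasing. -/
theorem G_antitone (m : ℝ) {x y : E4} (hx : x ≠ 0) (h : ‖x‖ ≤ ‖y‖) : G m y ≤ G m x := by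
  have hy : y ≠ 0 := by
    intro h0; rw [h0, norm_zero] at h; exact hx (norm_eq_zero.1 (le_antisymm h (norm_nonneg _)))
  rw [G_eq, G_eq]
  refine setIntegral_mono_on (integrableOn_expφ (norm_ne_zero_iff.2 hy)) (integrableOn_expφ (norm_ne_zero_iff.2 hx))
    measurableSet_Ioi fun t ht => ?_
  exact mul_le_mul_of_nonneg_left (φ_antitone (norm_nonneg _) h (mem_Ioi.1 ht)) (Real.exp_pos _).le

/-- `G_m` is continuous off the origin (dominated convergence under the subordination integral). -/
theorem continuousOn_G (m : ℝ) : ContinuousOn (G m) {x : E4 | x ≠ 0} := by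
  intro x₀ hx₀
  have hρ : 0 < ‖x₀‖ / 2 := half_pos (norm_pos_iff.2 hx₀)
  set ρ := ‖x₀‖ / 2 with hρdef
  set U : Set E4 := {x | ρ < ‖x‖} with hU
  have hUopen : IsOpen U := isOpen_lt continuous_const continuous_norm
  have hx₀U : x₀ ∈ U := by show ρ < ‖x₀‖; rw [hρdef]; linarith [norm_pos_iff.2 hx₀]
  have hcont : ContinuousOn (G m) U := by
    have hGU : ∀ x ∈ U, G m x = ∫ t in Ioi (0 : ℝ), Real.exp (-m ^ 2 * t) * φ ‖x‖ t := fun x _ => G_eq m x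
    refine ContinuousOn.congr ?_ hGU
    refine continuousOn_of_dominated (F := fun x t => Real.exp (-m ^ 2 * t) * φ ‖x‖ t)
      (bound := fun t => φ ρ t) (μ := volume.restrict (Ioi (0 : ℝ))) ?_ ?_ ?_ ?_
    · intro x _
      exact (Measurable.mul (by fun_prop) (by unfold φ; fun_prop : Measurable fun t => φ ‖x‖ t)).aestronglyMeasurable
    · intro x hx
      refine ae_restrict_of_forall_mem measurableSet_Ioi fun t ht => ?_
      rw [Real.norm_of_nonneg (mul_nonneg (Real.exp_pos _).le (φ_nonneg _ _))]
      calc Real.exp (-m ^ 2 * t) * φ ‖x‖ t ≤ 1 * φ ‖x‖ t := by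
            refine mul_le_mul_of_nonneg_right ?_ (φ_nonneg _ _)
            rw [Real.exp_le_one_iff]; nlinarith [mem_Ioi.1 ht, sq_nonneg m]
        _ = φ ‖x‖ t := one_mul _
        _ ≤ φ ρ t := φ_antitone hρ.le (le_of_lt hx) (mem_Ioi.1 ht)
    · exact integrableOn_φ_Ioi hρ.ne' le_rfl
    · refine ae_restrict_of_forall_mem measurableSet_Ioi fun t ht => ?_
      have ht0 : (4 * π * t) ^ 2 ≠ 0 := by have := mem_Ioi.1 ht; positivity
      have : Continuous fun x : E4 => Real.exp (-m ^ 2 * t) * φ ‖x‖ t := by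
        unfold φ
        exact continuous_const.mul ((continuous_const).mul (Real.continuous_exp.comp
          ((continuous_norm.pow 2).neg.div_const _)))
      exact this.continuousOn
  exact (hcont.continuousAt (hUopen.mem_nhds hx₀U)).continuousWithinAt

/-- Joint measurability of `(m, x) ↦ G_m(x)`. -/
theorem measurable_G_uncurry : Measurable fun p : ℝ × E4 => G p.1 p.2 := by
  have hmeas : Measurable fun q : (ℝ × E4) × ℝ =>
      Real.exp (-q.1.1 ^ 2 * q.2) * heatKernel q.2 q.1.2 := by
    unfold heatKernel; fun_prop
  exact (hmeas.stronglyMeasurable.integral_prod_right' (ν := volume.restrict (Ioi (0 : ℝ)))).measurable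

/-! ### The dimension-5 generalised free field kernel `K₅(w) = ∫_{μ>2} μ⁷ G_μ(w) dμ` -/

/-- The Källén–Lehmann integrand `μ⁷ G_μ(w)` (spectral weight `ρ(μ²) dμ² ∝ μ⁷ dμ`, dimension `5`). -/
def K5int (w : E4) (μ : ℝ) : ℝ := μ ^ 7 * G μ w

/-- **The witness kernel** `K₅(w) = ∫_{μ>2} μ⁷ G_μ(w) dμ`: a positive combination of free propagators of
masses `μ > 2` — `O(4)`-invariant, reflection positive in EVERY frame, exponentially decaying, of order ten. -/
def K5 (w : E4) : ℝ := ∫ μ in Ioi (2 : ℝ), K5int w μ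

/-- Auxiliary fact `K5int_nonneg` of the generalised-free-field witness (see the module docstring). [folklore] -/
theorem K5int_nonneg (w : E4) {μ : ℝ} (hμ : 0 ≤ μ) : 0 ≤ K5int w μ :=
  mul_nonneg (pow_nonneg hμ 7) (G_nonneg μ w)

/-- Auxiliary fact `K5_nonneg` of the generalised-free-field witness (see the module docstring). [folklore] -/
theorem K5_nonneg (w : E4) : 0 ≤ K5 w :=
  setIntegral_nonneg measurableSet_Ioi fun _ hμ => K5int_nonneg w ((zero_le_two).trans (le_of_lt hμ))

/-- Auxiliary fact `measurable_K5int_uncurry` of the generalised-free-field witness (see the module docstring). [folklore] -/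
theorem measurable_K5int_uncurry : Measurable fun p : E4 × ℝ => K5int p.1 p.2 := by
  unfold K5int
  exact (measurable_snd.pow_const 7).mul (measurable_G_uncurry.comp (measurable_snd.prodMk measurable_fst))

/-- Auxiliary fact `measurable_K5` of the generalised-free-field witness (see the module docstring). [folklore] -/
theorem measurable_K5 : Measurable K5 :=
  (measurable_K5int_uncurry.stronglyMeasurable.integral_prod_right'
    (ν := volume.restrict (Ioi (2 : ℝ)))).measurable

/-- Upper bound of the integrand: `μ⁷ G_μ(w) ≤ (2π²‖w‖²)⁻¹ · μ⁷ e^{-μ‖w‖/2}`. -/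
theorem K5int_le {w : E4} (hw : w ≠ 0) (μ : ℝ) (hμ : 0 ≤ μ) :
    K5int w μ ≤ (1 / (2 * π ^ 2 * ‖w‖ ^ 2)) * eint 7 (‖w‖ / 2) μ := by
  unfold K5int eint
  have h := G_le_exp μ hw
  calc μ ^ 7 * G μ w ≤ μ ^ 7 * (Real.exp (-(μ * ‖w‖ / 2)) * (1 / (2 * π ^ 2 * ‖w‖ ^ 2))) :=
        mul_le_mul_of_nonneg_left h (pow_nonneg hμ 7)
    _ = (1 / (2 * π ^ 2 * ‖w‖ ^ 2)) * (μ ^ 7 * Real.exp (-(‖w‖ / 2 * μ))) := by ring_nf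

/-- Lower bound of the integrand: `(4π²‖w‖²)⁻¹ · μ⁷ e^{-μ‖w‖} ≤ μ⁷ G_μ(w)` (`μ > 0`). -/
theorem K5int_ge {w : E4} (hw : w ≠ 0) {μ : ℝ} (hμ : 0 < μ) :
    (1 / (4 * π ^ 2 * ‖w‖ ^ 2)) * eint 7 ‖w‖ μ ≤ K5int w μ := by
  unfold K5int eint
  have h := G_ge hμ hw
  calc (1 / (4 * π ^ 2 * ‖w‖ ^ 2)) * (μ ^ 7 * Real.exp (-(‖w‖ * μ)))
      = μ ^ 7 * (Real.exp (-(μ * ‖w‖)) / (4 * π ^ 2 * ‖w‖ ^ 2)) := by ring_nf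
    _ ≤ μ ^ 7 * G μ w := mul_le_mul_of_nonneg_left h (pow_nonneg hμ.le 7)

/-- Auxiliary fact `integrableOn_K5int` of the generalised-free-field witness (see the module docstring). [folklore] -/
theorem integrableOn_K5int {w : E4} (hw : w ≠ 0) : IntegrableOn (K5int w) (Ioi 2) := by
  have hr : 0 < ‖w‖ / 2 := half_pos (norm_pos_iff.2 hw)
  refine ((integrableOn_eint 7 zero_le_two hr).const_mul (1 / (2 * π ^ 2 * ‖w‖ ^ 2))).mono' ?_ ?_
  · exact (measurable_K5int_uncurry.comp (measurable_const.prodMk measurable_id)).aestronglyMeasurable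
  · refine ae_restrict_of_forall_mem measurableSet_Ioi fun μ hμ => ?_
    have hμ0 : 0 ≤ μ := zero_le_two.trans (le_of_lt hμ)
    rw [Real.norm_of_nonneg (K5int_nonneg w hμ0)]
    exact K5int_le hw μ hμ0

/-- The order-ten constant `A₅ = 7!·2⁸/(2π²)`. -/
def A5 : ℝ := Nat.factorial 7 * 2 ^ 8 / (2 * π ^ 2)

/-- Auxiliary fact `A5_pos` of the generalised-free-field witness (see the module docstring). [folklore] -/
theorem A5_pos : 0 < A5 := by unfold A5; positivity

/-- **Upper bound** `K₅(w) ≤ A₅ ‖w‖⁻¹⁰`. -/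
theorem K5_le {w : E4} (hw : w ≠ 0) : K5 w ≤ A5 * ‖w‖⁻¹ ^ 10 := by
  have hr0 : 0 < ‖w‖ := norm_pos_iff.2 hw
  have hr : 0 < ‖w‖ / 2 := half_pos hr0
  calc K5 w ≤ ∫ μ in Ioi (2 : ℝ), (1 / (2 * π ^ 2 * ‖w‖ ^ 2)) * eint 7 (‖w‖ / 2) μ :=
        setIntegral_mono_on (integrableOn_K5int hw)
          ((integrableOn_eint 7 zero_le_two hr).const_mul _) measurableSet_Ioi
          fun μ hμ => K5int_le hw μ (zero_le_two.trans (le_of_lt hμ))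
    _ = (1 / (2 * π ^ 2 * ‖w‖ ^ 2)) * eul 7 2 (‖w‖ / 2) := by rw [integral_const_mul]; rfl
    _ ≤ (1 / (2 * π ^ 2 * ‖w‖ ^ 2)) * (Nat.factorial 7 * (‖w‖ / 2)⁻¹ ^ 8) :=
        mul_le_mul_of_nonneg_left (eul_le 7 zero_le_two hr) (by positivity)
    _ = A5 * ‖w‖⁻¹ ^ 10 := by
        have e : (‖w‖ / 2)⁻¹ ^ 8 = 2 ^ 8 * ‖w‖⁻¹ ^ 8 := by rw [inv_div, div_eq_mul_inv, mul_pow]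
        rw [e]
        unfold A5
        field_simp

/-- **Order ten**: `e⁻²/(4π²) · ‖w‖⁻¹⁰ ≤ K₅(w)` for `0 < ‖w‖ ≤ 1/2`. -/
theorem K5_ge {w : E4} (hw : w ≠ 0) (hw2 : ‖w‖ ≤ 1 / 2) :
    Real.exp (-2) / (4 * π ^ 2) * ‖w‖⁻¹ ^ 10 ≤ K5 w := by
  have hr0 : 0 < ‖w‖ := norm_pos_iff.2 hw
  have har : (2 : ℝ) ≤ ‖w‖⁻¹ := by
    rw [le_inv_comm₀ two_pos hr0]; linarith
  calc Real.exp (-2) / (4 * π ^ 2) * ‖w‖⁻¹ ^ 10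
      = (1 / (4 * π ^ 2 * ‖w‖ ^ 2)) * (Real.exp (-2) * ‖w‖⁻¹ ^ 8) := by
        field_simp
    _ ≤ (1 / (4 * π ^ 2 * ‖w‖ ^ 2)) * eul 7 2 ‖w‖ :=
        mul_le_mul_of_nonneg_left (eul_ge 7 zero_le_two hr0 har) (by positivity)
    _ = ∫ μ in Ioi (2 : ℝ), (1 / (4 * π ^ 2 * ‖w‖ ^ 2)) * eint 7 ‖w‖ μ := by
        rw [integral_const_mul]; rfl
    _ ≤ K5 w :=
        setIntegral_mono_on ((integrableOn_eint 7 zero_le_two hr0).const_mul _) (integrableOn_K5int hw)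
          measurableSet_Ioi fun μ hμ => K5int_ge hw (two_pos.trans (mem_Ioi.1 hμ))

/-- **Exponential decay**: `K₅(w) ≤ (e² eul 7 2 1 / (2π²)) · e^{-‖w‖}` for `‖w‖ ≥ 2`. -/
theorem K5_le_exp {w : E4} (hw : 2 ≤ ‖w‖) :
    K5 w ≤ (Real.exp 2 * eul 7 2 1 / (2 * π ^ 2)) * Real.exp (-‖w‖) := by
  have hr0 : 0 < ‖w‖ := two_pos.trans_le hw
  have hw0 : w ≠ 0 := norm_pos_iff.1 hr0
  have hr : 0 < ‖w‖ / 2 := half_pos hr0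
  have h1 : 1 ≤ ‖w‖ / 2 := by linarith
  calc K5 w ≤ (1 / (2 * π ^ 2 * ‖w‖ ^ 2)) * eul 7 2 (‖w‖ / 2) := by
        calc K5 w ≤ ∫ μ in Ioi (2 : ℝ), (1 / (2 * π ^ 2 * ‖w‖ ^ 2)) * eint 7 (‖w‖ / 2) μ :=
              setIntegral_mono_on (integrableOn_K5int hw0)
                ((integrableOn_eint 7 zero_le_two hr).const_mul _) measurableSet_Ioi
                fun μ hμ => K5int_le hw0 μ (zero_le_two.trans (le_of_lt hμ))
          _ = (1 / (2 * π ^ 2 * ‖w‖ ^ 2)) * eul 7 2 (‖w‖ / 2) := by rw [integral_const_mul]; rfl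
    _ ≤ (1 / (2 * π ^ 2 * 1)) * (Real.exp (2 * (1 - ‖w‖ / 2)) * eul 7 2 1) := by
        gcongr
        · exact eul_nonneg 7 zero_le_two _
        · nlinarith
        · exact eul_le_exp 7 zero_le_two h1
    _ = (Real.exp 2 * eul 7 2 1 / (2 * π ^ 2)) * Real.exp (-‖w‖) := by
        rw [show 2 * (1 - ‖w‖ / 2) = 2 + -‖w‖ by ring, Real.exp_add]
        ring

/-- `K₅` is `O(4)`-invariant. -/
theorem K5_isometry (R : E4 ≃ₗᵢ[ℝ] E4) (w : E4) : K5 (R w) = K5 w := by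
  unfold K5 K5int
  simp_rw [G_isometry]

/-- Auxiliary fact `K5_neg` of the generalised-free-field witness (see the module docstring). [folklore] -/
theorem K5_neg (w : E4) : K5 (-w) = K5 w := by
  unfold K5 K5int
  simp_rw [G_neg]

/-- `K₅` is radially non-increasing. -/
theorem K5_antitone {x y : E4} (hx : x ≠ 0) (h : ‖x‖ ≤ ‖y‖) : K5 y ≤ K5 x := by
  have hy : y ≠ 0 := by
    intro h0; rw [h0, norm_zero] at h; exact hx (norm_eq_zero.1 (le_antisymm h (norm_nonneg _)))
  refine setIntegral_mono_on (integrableOn_K5int hy) (integrableOn_K5int hx) measurableSet_Ioi fun μ hμ => ?_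
  unfold K5int
  exact mul_le_mul_of_nonneg_left (G_antitone μ hx h) (pow_nonneg (zero_le_two.trans (le_of_lt hμ)) 7)

/-- `K₅` is continuous off the origin. -/
theorem continuousOn_K5 : ContinuousOn K5 {w : E4 | w ≠ 0} := by
  intro x₀ hx₀
  have hρ : 0 < ‖x₀‖ / 2 := half_pos (norm_pos_iff.2 hx₀)
  set ρ := ‖x₀‖ / 2 with hρdef
  set U : Set E4 := {x | ρ < ‖x‖} with hU
  have hUopen : IsOpen U := isOpen_lt continuous_const continuous_norm
  have hx₀U : x₀ ∈ U := by show ρ < ‖x₀‖; rw [hρdef]; linarith [norm_pos_iff.2 hx₀]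
  have hUne : ∀ x ∈ U, x ≠ 0 := fun x hx h0 => by
    rw [h0] at hx; simp [hU] at hx; linarith
  have hcont : ContinuousOn K5 U := by
    refine continuousOn_of_dominated (F := fun x μ => K5int x μ)
      (bound := fun μ => (1 / (2 * π ^ 2 * ρ ^ 2)) * eint 7 (ρ / 2) μ)
      (μ := volume.restrict (Ioi (2 : ℝ))) ?_ ?_ ?_ ?_
    · intro x _
      exact (measurable_K5int_uncurry.comp (measurable_const.prodMk measurable_id)).aestronglyMeasurable
    · intro x hx
      refine ae_restrict_of_forall_mem measurableSet_Ioi fun μ hμ => ?_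
      have hμ0 : 0 ≤ μ := zero_le_two.trans (le_of_lt hμ)
      rw [Real.norm_of_nonneg (K5int_nonneg x hμ0)]
      have hxρ : ρ ≤ ‖x‖ := le_of_lt hx
      calc K5int x μ ≤ (1 / (2 * π ^ 2 * ‖x‖ ^ 2)) * eint 7 (‖x‖ / 2) μ := K5int_le (hUne x hx) μ hμ0
        _ ≤ (1 / (2 * π ^ 2 * ρ ^ 2)) * eint 7 (ρ / 2) μ := by
            gcongr
            · exact eint_nonneg 7 _ hμ0
            · exact eint_antitone 7 (by linarith) hμ0
    · exact (integrableOn_eint 7 zero_le_two (half_pos hρ)).const_mul _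
    · refine ae_restrict_of_forall_mem measurableSet_Ioi fun μ _ => ?_
      unfold K5int
      exact (continuousOn_const.mul ((continuousOn_G μ).mono fun x hx => hUne x hx))
  exact (hcont.continuousAt (hUopen.mem_nhds hx₀U)).continuousWithinAt

/-- **Time decay** `K₅(w − t e₀) ≤ e²(1 + eul 7 2 1)·e^{-t}·(1 + K₅(w))` for `w⁰ ≤ 0`, `w ≠ 0`, `t ≥ 0`. -/
theorem K5_sub_time_le {w : E4} (hw : w 0 ≤ 0) (hw0 : w ≠ 0) {t : ℝ} (ht : 0 ≤ t) :
    K5 (w - EuclideanSpace.single 0 t) ≤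
      Real.exp 2 * (1 + eul 7 2 1) * Real.exp (-t) * (1 + K5 w) := by
  have hE : 0 ≤ eul 7 2 1 := eul_nonneg 7 zero_le_two 1
  have hK : 0 ≤ K5 w := K5_nonneg w
  -- ‖w − t e₀‖ ≥ ‖w‖ and ≥ t
  have hnorm_sq : ‖w - EuclideanSpace.single 0 t‖ ^ 2 = ‖w‖ ^ 2 - 2 * t * w 0 + t ^ 2 := by
    have hsum : ∀ v : E4, ‖v‖ ^ 2 = v 0 ^ 2 + ∑ k : Fin 3, v k.succ ^ 2 := fun v => by
      rw [EuclideanSpace.real_norm_sq_eq, Fin.sum_univ_succ]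
    have h0 : (w - EuclideanSpace.single 0 t : E4) 0 = w 0 - t := by simp
    have hk : ∀ k : Fin 3, (w - EuclideanSpace.single 0 t : E4) k.succ = w k.succ := fun k => by simp
    rw [hsum, hsum, h0]
    simp only [hk]
    ring
  have hge1 : ‖w‖ ≤ ‖w - EuclideanSpace.single 0 t‖ := by
    apply le_of_sq_le_sq _ (norm_nonneg _)
    rw [hnorm_sq]; nlinarith
  have hge2 : t ≤ ‖w - EuclideanSpace.single 0 t‖ := by
    apply le_of_sq_le_sq _ (norm_nonneg _)
    rw [hnorm_sq]; nlinarith [sq_nonneg ‖w‖]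
  by_cases h2 : 2 ≤ t
  · -- large t: exponential decay of K₅ at radius ≥ t
    have hv0 : w - EuclideanSpace.single 0 t ≠ 0 := by
      intro h0; rw [h0, norm_zero] at hge2; linarith
    calc K5 (w - EuclideanSpace.single 0 t)
        ≤ (Real.exp 2 * eul 7 2 1 / (2 * π ^ 2)) * Real.exp (-‖w - EuclideanSpace.single 0 t‖) :=
          K5_le_exp (h2.trans hge2)
      _ ≤ (Real.exp 2 * eul 7 2 1 / (2 * π ^ 2)) * Real.exp (-t) := by
          gcongr
      _ ≤ Real.exp 2 * (1 + eul 7 2 1) * Real.exp (-t) * (1 + K5 w) := by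
          have hπ : 1 ≤ 2 * π ^ 2 := by nlinarith [Real.pi_gt_three]
          have : Real.exp 2 * eul 7 2 1 / (2 * π ^ 2) ≤ Real.exp 2 * (1 + eul 7 2 1) := by
            rw [div_le_iff₀ (by positivity)]
            nlinarith [Real.exp_pos 2, mul_nonneg (Real.exp_pos 2).le hE]
          calc (Real.exp 2 * eul 7 2 1 / (2 * π ^ 2)) * Real.exp (-t)
              ≤ Real.exp 2 * (1 + eul 7 2 1) * Real.exp (-t) :=
                mul_le_mul_of_nonneg_right this (Real.exp_pos _).le
            _ ≤ Real.exp 2 * (1 + eul 7 2 1) * Real.exp (-t) * (1 + K5 w) :=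
                le_mul_of_one_le_right (by positivity) (by linarith)
  · -- small t: monotonicity, `e^{2-t} ≥ 1`
    have hlt : t < 2 := lt_of_not_ge h2
    calc K5 (w - EuclideanSpace.single 0 t) ≤ K5 w := K5_antitone hw0 hge1
      _ ≤ Real.exp 2 * Real.exp (-t) * K5 w := by
          refine le_mul_of_one_le_left hK ?_
          rw [← Real.exp_add]; exact Real.one_le_exp (by linarith)
      _ ≤ Real.exp 2 * Real.exp (-t) * (1 + K5 w) := by
          nlinarith [mul_pos (Real.exp_pos 2) (Real.exp_pos (-t))]
      _ = Real.exp 2 * Real.exp (-t) * (1 + K5 w) * 1 := by ring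
      _ ≤ Real.exp 2 * Real.exp (-t) * (1 + K5 w) * (1 + eul 7 2 1) :=
          mul_le_mul_of_nonneg_left (by linarith) (by positivity)
      _ = Real.exp 2 * (1 + eul 7 2 1) * Real.exp (-t) * (1 + K5 w) := by ring

end GFF

end Summit.QuantumFields.YangMills.Theorems.CurvatureKernelBound.Negative
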